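import Literature.NumberTheory.Rogawski1990.ArchStableOrbitalWallStepFamily    -- ★ p841638 (R1-e″): multi-family one-step jump; brings ★ p841391, ★ (R1-a), ★ (δ8), ★ (R1-f)
import HarnessLib

/-!
# THE WALL DATA OF ONE DIAGONAL CARRIER: the per-place jump coefficients `κ_v(ρ)`, wall orbit measures `Wm_v(ρ)` (Radon) and the one-step jump law for the scaled
# orbit-measure state `K⁻¹·∫ Θ d(⊗_v μ_v)` — the `hstep`∕`hWm` package of ★ p841576 for one inner form, all places ((R1-e-pkg); Rogawski 1990 §8.2, §14.5)

Topic `NumberTheory/Rogawski1990`; namespace `Literature.NumberTheory.Rogawski1990`.  THEOREMS ONLY (no `def`, no instance, no notation, no axiom, no `sorry`).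
Cell `pub/hodgecm-mathlib`, ENGINE T1 (crux H413 = `stmt-HodgeConjecture-24833`); floor-2 road «(J-nc) in-house», brick (R1-e-pkg) of R1 `stub_LuseAllPlaces` (LEAD F0P3a-plan (g9)
WORD T8-77; census `CENSUS-R1e-LuseAssembly` 31a194b6 (m4); author F0P3a-p07 (g7), 2026-09-01).

WHY ONE SIDE AT A TIME.  ★ p841576 `PlaceInduction.sum_prod_mul_eq_of_step_of_regular_eq` compares TWO systems; each system's `hstep`, `hWm`, `hR` are produced HERE for one diagonal
carrier `U(diag α)` with ALL places' data indexed by the place (`νw v`, `νH v τ`, the transported Haar measures `ντ v τ = (νw v).map e_τ⁻¹` passed as DATA so that no instance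
search ever runs on a `Measure.map` term), and the consumer obtains the two packages separately and feeds them to ★ p841576 — keeping the two carriers' instance families out of each
other's elaboration.
* `isFiniteMeasureOnCompacts_and_sigmaFinite_map_conj_of_injective` (`hR`: regular orbit measures are Radon, ★ p840971 §3 + ★ p841391 §1);
* `exists_wallCoef_hstep` — THE PACKAGE: `∃ c : W → S₃ → ℂ` (J1's constants per place, `≠ 0` at noncompact walls) such that (i) every wall measure `Wm_v(ρ) = (cw ? (νw v).map conj_{diag(z⁰_v∘ρ)} :
  μ^{sing}_{v,ρ})` is Radon and (ii) the one-step jump law of ★ p841576's `hstep` holds at every place `w` for the SCALED state `I(μ) = K_α⁻¹·∫ Θ ↑↑(e⁻¹ o) d(⊗_v μ_v)` with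
  `R_v(u) = (νw v).map conj_{diag u}`, `κ_v(ρ) = (cw ? 2 : c_v(ρ⁻¹))` (★ p841638 at `w`, scalars `s_i·K⁻¹`).
HONEST LABEL: HC_CM is proved only modulo the 7 printed citations until rung 0 closes; this file is the assembly of ★ bricks and pays nothing by itself.

## References
* [Rogawski1990] J. D. Rogawski, *Automorphic Representations of Unitary Groups in Three Variables*, Ann. of Math. Stud. 123 (1990), §8.2 p. 122–124, §14.5 p. 238–239.
* [Varadarajan1989] V. S. Varadarajan, *An Introduction to Harmonic Analysis on Semisimple Lie Groups* (1989), §6.4 Thm 22.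
* [DeitmarEchterhoff2014] A. Deitmar, S. Echterhoff, *Principles of Harmonic Analysis*, 2nd ed. (2014), Lemma 9.3.3.
-/

set_option autoImplicit false

noncomputable section

open MeasureTheory Measure Filter Topology NumberField NumberField.InfinitePlace NumberField.mixedEmbedding Equiv Function Set
open Literature.MeasureTheory.Group Literature.NumberTheory.Automorphic Literature.NumberTheory.Automorphic.UnitaryGroup
open Literature.LinearAlgebra.Matrix
open scoped Matrix MatrixGroups Matrix.Norms.Operator ContDiff

namespace Literature.NumberTheory.Rogawski1990

variable (L : Type) [Field L] [NumberField L] [IsCMField L] (α : Fin 3 → L)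
  [MeasurableSpace (GL (Fin 3) ℂ)] [BorelSpace (GL (Fin 3) ℂ)]

omit [NumberField L] [IsCMField L] in
/-- **`hR`: REGULAR ORBIT MEASURES ARE RADON** — finite on compacts (proper orbit map ★ p840971 §3, ★ p841391 §1) and σ-finite. [cite: Rogawski1990, §8.3 p. 122] [cite: DeitmarEchterhoff2014, Lemma 9.3.3] -/
theorem isFiniteMeasureOnCompacts_and_sigmaFinite_map_conj_of_injective (hα : ∀ i, α i ≠ 0) (v : {w : InfinitePlace L // IsComplex w})
    (ν : Measure (archLocal L 3 (Matrix.diagonal α) v)) [IsFiniteMeasureOnCompacts ν] (u : Fin 3 → Circle) (hu : Function.Injective u) :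
    IsFiniteMeasureOnCompacts (ν.map fun y : archLocal L 3 (Matrix.diagonal α) v =>
        y * (⟨circleDiagonal 3 u, circleDiagonal_mem_archLocal_diagonal L 3 α v u⟩ : archLocal L 3 (Matrix.diagonal α) v) * y⁻¹) ∧
      SigmaFinite (ν.map fun y : archLocal L 3 (Matrix.diagonal α) v =>
        y * (⟨circleDiagonal 3 u, circleDiagonal_mem_archLocal_diagonal L 3 α v u⟩ : archLocal L 3 (Matrix.diagonal α) v) * y⁻¹) := by
  haveI : LocallyCompactSpace (archLocal L 3 (Matrix.diagonal α) v) := locallyCompactSpace_archLocal L 3 (Matrix.diagonal α) v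
  haveI : SecondCountableTopology (archLocal L 3 (Matrix.diagonal α) v) := secondCountableTopology_archLocal L 3 (Matrix.diagonal α) v
  haveI := isFiniteMeasureOnCompacts_map_conj_of_proper L 3 α v ν _ fun C hC =>
    isCompact_setOf_conj_circleDiagonal_mem_of_injective L 3 α v hα u hu C hC
  exact ⟨this, inferInstance⟩

variable [MeasurableSpace (arch (↥(maximalRealSubfield L)) L (IsCMField.complexConj L) 3 (Matrix.diagonal α))] [BorelSpace (arch (↥(maximalRealSubfield L)) L (IsCMField.complexConj L) 3 (Matrix.diagonal α))]

open scoped Classical in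
/-- ★ p841638 with the transported Haar measures `ν.map e_τ⁻¹` on the relabelled groups passed as DATA `ντ` (so that consumers indexing everything by the place never run an
instance search on a `Measure.map` term). [cite: Rogawski1990, §8.2 p. 124] -/
theorem exists_tendsto_deriv_sin_mul_sum_sum_integral_pi_update_splitCurve_of_eq (w : {w : InfinitePlace L // IsComplex w})
    (hα : ∀ i, α i ≠ 0) (hherm : ∀ i, (IsCMField.complexConj L (α i) : L) = α i)
    (ν : Measure (archLocal L 3 (Matrix.diagonal α) w)) [ν.IsHaarMeasure] [ν.IsMulRightInvariant]
    (z₁ : Fin 3 → Circle) (h02 : z₁ 0 = z₁ 2) (h01 : z₁ 0 ≠ z₁ 1)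
    [∀ τ : Perm (Fin 3), MeasurableSpace (archLocal L 3 (Matrix.diagonal (α ∘ ⇑τ)) w ⧸ Subgroup.centralizer
      ({(⟨circleDiagonal 3 z₁, circleDiagonal_mem_archLocal_diagonal L 3 (α ∘ ⇑τ) w z₁⟩ : archLocal L 3 (Matrix.diagonal (α ∘ ⇑τ)) w)} :
        Set (archLocal L 3 (Matrix.diagonal (α ∘ ⇑τ)) w)))]
    [∀ τ : Perm (Fin 3), BorelSpace (archLocal L 3 (Matrix.diagonal (α ∘ ⇑τ)) w ⧸ Subgroup.centralizer
      ({(⟨circleDiagonal 3 z₁, circleDiagonal_mem_archLocal_diagonal L 3 (α ∘ ⇑τ) w z₁⟩ : archLocal L 3 (Matrix.diagonal (α ∘ ⇑τ)) w)} :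
        Set (archLocal L 3 (Matrix.diagonal (α ∘ ⇑τ)) w)))]
    (νH : ∀ τ : Perm (Fin 3), Measure (Subgroup.centralizer
      ({(⟨circleDiagonal 3 z₁, circleDiagonal_mem_archLocal_diagonal L 3 (α ∘ ⇑τ) w z₁⟩ : archLocal L 3 (Matrix.diagonal (α ∘ ⇑τ)) w)} :
        Set (archLocal L 3 (Matrix.diagonal (α ∘ ⇑τ)) w))))
    [∀ τ, (νH τ).IsHaarMeasure] [∀ τ, (νH τ).IsInvInvariant]
    (ντ : ∀ τ : Perm (Fin 3), Measure (archLocal L 3 (Matrix.diagonal (α ∘ ⇑τ)) w))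
    [∀ τ, (ντ τ).IsHaarMeasure] [∀ τ, (ντ τ).IsMulRightInvariant]
    (hντ : ντ = fun τ => ν.map (ContinuousMulEquiv.restrictSubgroup (GLn.conjEquiv (Matrix.GeneralLinearGroup.mkOfDetNeZero _ (det_monomial_one_ne_zero 3 τ)))
            (archLocal L 3 (Matrix.diagonal (α ∘ ⇑τ)) w) (archLocal L 3 (Matrix.diagonal α) w)
            (mem_archLocal_comp_perm_iff_conj_mem L 3 α w τ)).symm) :
    haveI : ∀ τ : Perm (Fin 3), LocallyCompactSpace (archLocal L 3 (Matrix.diagonal (α ∘ ⇑τ)) w) := fun τ => locallyCompactSpace_archLocal L 3 (Matrix.diagonal (α ∘ ⇑τ)) w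
    haveI : ∀ τ : Perm (Fin 3), SecondCountableTopology (archLocal L 3 (Matrix.diagonal (α ∘ ⇑τ)) w) := fun τ => secondCountableTopology_archLocal L 3 (Matrix.diagonal (α ∘ ⇑τ)) w
    ∃ c : Perm (Fin 3) → ℂ,
      (∀ τ : Perm (Fin 3), (w.1.embedding (α (τ 0))).re * (w.1.embedding (α (τ 2))).re < 0 → c τ ≠ 0) ∧
      ∀ (Θ : Matrix (Fin 3) (Fin 3) (mixedSpace L) → ℂ), ContDiff ℝ (⊤ : ℕ∞) Θ →
        HasCompactSupport (fun g : arch (↥(maximalRealSubfield L)) L (IsCMField.complexConj L) 3 (Matrix.diagonal α) => Θ ((g : GL (Fin 3) (mixedSpace L)) : Matrix (Fin 3) (Fin 3) (mixedSpace L))) →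
        ∀ (ι : Type) [Fintype ι] (s : ι → ℂ) (μfam : ι → ∀ v : {w : InfinitePlace L // IsComplex w}, Measure (archLocal L 3 (Matrix.diagonal α) v)),
        (∀ i v, IsFiniteMeasureOnCompacts (μfam i v) ∧ SigmaFinite (μfam i v)) →
        ∀ (z₀ : Fin 3 → Circle) (h02' : z₀ 0 = z₀ 2) (h01' : z₀ 0 ≠ z₀ 1),
          Tendsto (fun ψ : ℝ => deriv (fun ψ : ℝ => (2 * Real.sin ψ : ℂ) * ∑ i, s i * ∑ ρ : Perm (Fin 3),
              ∫ o, Θ ((((archPiEquivCM 3 L (Matrix.diagonal α)).symm o : arch (↥(maximalRealSubfield L)) L (IsCMField.complexConj L) 3 (Matrix.diagonal α)) : GL (Fin 3) (mixedSpace L)) : Matrix (Fin 3) (Fin 3) (mixedSpace L))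
                ∂(Measure.pi (Function.update (μfam i) w (ν.map fun y : archLocal L 3 (Matrix.diagonal α) w => y * (⟨circleDiagonal 3 ((fun i => z₀ i * Circle.exp (![(1 : ℝ), 0, -1] i * ψ)) ∘ ⇑ρ), circleDiagonal_mem_archLocal_diagonal L 3 α w ((fun i => z₀ i * Circle.exp (![(1 : ℝ), 0, -1] i * ψ)) ∘ ⇑ρ)⟩ : archLocal L 3 (Matrix.diagonal α) w) * y⁻¹)))) ψ)
            (𝓝[>] 0)
            (𝓝 (∑ i, s i * ∑ ρ : Perm (Fin 3),
              (if 0 < (w.1.embedding (α (ρ⁻¹ 0))).re * (w.1.embedding (α (ρ⁻¹ 2))).re then (2 : ℂ) else c ρ⁻¹) *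
                ∫ o, Θ ((((archPiEquivCM 3 L (Matrix.diagonal α)).symm o : arch (↥(maximalRealSubfield L)) L (IsCMField.complexConj L) 3 (Matrix.diagonal α)) : GL (Fin 3) (mixedSpace L)) : Matrix (Fin 3) (Fin 3) (mixedSpace L))
                ∂(Measure.pi (Function.update (μfam i) w (if 0 < (w.1.embedding (α (ρ⁻¹ 0))).re * (w.1.embedding (α (ρ⁻¹ 2))).re then ν.map fun y : archLocal L 3 (Matrix.diagonal α) w => y * (⟨circleDiagonal 3 (z₀ ∘ ⇑ρ), circleDiagonal_mem_archLocal_diagonal L 3 α w (z₀ ∘ ⇑ρ)⟩ : archLocal L 3 (Matrix.diagonal α) w) * y⁻¹ else ((quotientMeasure _ (νH ρ⁻¹) (isClosed_coe_centralizer_singleton _) (ντ ρ⁻¹)).map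
                  (descConj (⟨circleDiagonal 3 z₀, circleDiagonal_mem_archLocal_diagonal L 3 (α ∘ ⇑ρ⁻¹) w z₀⟩ : archLocal L 3 (Matrix.diagonal (α ∘ ⇑ρ⁻¹)) w)
                    (Subgroup.centralizer ({(⟨circleDiagonal 3 z₁, circleDiagonal_mem_archLocal_diagonal L 3 (α ∘ ⇑ρ⁻¹) w z₁⟩ :
                      archLocal L 3 (Matrix.diagonal (α ∘ ⇑ρ⁻¹)) w)} : Set (archLocal L 3 (Matrix.diagonal (α ∘ ⇑ρ⁻¹)) w)))
                    (forall_mem_centralizer_circleDiagonal_comm_of_wall L (α ∘ ⇑ρ⁻¹) w h02 h01 h02' h01') id)).map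
                  (ContinuousMulEquiv.restrictSubgroup (GLn.conjEquiv (Matrix.GeneralLinearGroup.mkOfDetNeZero _ (det_monomial_one_ne_zero 3 ρ⁻¹)))
            (archLocal L 3 (Matrix.diagonal (α ∘ ⇑ρ⁻¹)) w) (archLocal L 3 (Matrix.diagonal α) w)
            (mem_archLocal_comp_perm_iff_conj_mem L 3 α w ρ⁻¹))))))) := by
  subst hντ
  exact exists_tendsto_deriv_sin_mul_sum_sum_integral_pi_update_splitCurve L α w hα hherm ν z₁ h02 h01 νH

open scoped Classical in
/-- **(R1-e-pkg) THE WALL DATA PACKAGE OF ONE DIAGONAL CARRIER** (all places): J1's constants `c_v`, the Radon-ness of every wall orbit measure `Wm_v(ρ)`, and the one-step jump law of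
★ p841576's `hstep` for the scaled state `K_α⁻¹·∫ Θ ↑↑(e⁻¹ o) d(⊗_v μ_v)` at every place (★ p841638). [cite: Rogawski1990, §8.2 p. 124; §14.5 p. 238–239] [cite: Varadarajan1989, §6.4 Thm 22] -/
theorem exists_wallCoef_hstep
    (hα : ∀ i, α i ≠ 0) (hherm : ∀ i, (IsCMField.complexConj L (α i) : L) = α i)
    (z0 : {w : InfinitePlace L // IsComplex w} → Fin 3 → Circle) (hwall : ∀ v, z0 v 0 = z0 v 2 ∧ z0 v 0 ≠ z0 v 1)
    (νw : ∀ v : {w : InfinitePlace L // IsComplex w}, Measure (archLocal L 3 (Matrix.diagonal α) v)) (hνw : ∀ v, (νw v).IsHaarMeasure ∧ (νw v).IsMulRightInvariant)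
    (z₁ : {w : InfinitePlace L // IsComplex w} → Fin 3 → Circle) (h02 : ∀ v, z₁ v 0 = z₁ v 2) (h01 : ∀ v, z₁ v 0 ≠ z₁ v 1)
    [∀ (v : {w : InfinitePlace L // IsComplex w}) (τ : Perm (Fin 3)), MeasurableSpace (archLocal L 3 (Matrix.diagonal (α ∘ ⇑τ)) v ⧸ Subgroup.centralizer
      ({(⟨circleDiagonal 3 (z₁ v), circleDiagonal_mem_archLocal_diagonal L 3 (α ∘ ⇑τ) v (z₁ v)⟩ : archLocal L 3 (Matrix.diagonal (α ∘ ⇑τ)) v)} :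
        Set (archLocal L 3 (Matrix.diagonal (α ∘ ⇑τ)) v)))]
    [∀ (v : {w : InfinitePlace L // IsComplex w}) (τ : Perm (Fin 3)), BorelSpace (archLocal L 3 (Matrix.diagonal (α ∘ ⇑τ)) v ⧸ Subgroup.centralizer
      ({(⟨circleDiagonal 3 (z₁ v), circleDiagonal_mem_archLocal_diagonal L 3 (α ∘ ⇑τ) v (z₁ v)⟩ : archLocal L 3 (Matrix.diagonal (α ∘ ⇑τ)) v)} :
        Set (archLocal L 3 (Matrix.diagonal (α ∘ ⇑τ)) v)))]
    (νH : ∀ (v : {w : InfinitePlace L // IsComplex w}) (τ : Perm (Fin 3)), Measure (Subgroup.centralizer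
      ({(⟨circleDiagonal 3 (z₁ v), circleDiagonal_mem_archLocal_diagonal L 3 (α ∘ ⇑τ) v (z₁ v)⟩ : archLocal L 3 (Matrix.diagonal (α ∘ ⇑τ)) v)} :
        Set (archLocal L 3 (Matrix.diagonal (α ∘ ⇑τ)) v))))
    (hνH : ∀ v τ, (νH v τ).IsHaarMeasure ∧ (νH v τ).IsInvInvariant)
    (ντ : ∀ (v : {w : InfinitePlace L // IsComplex w}) (τ : Perm (Fin 3)), Measure (archLocal L 3 (Matrix.diagonal (α ∘ ⇑τ)) v))
    (hντi : ∀ v τ, (ντ v τ).IsHaarMeasure ∧ (ντ v τ).IsMulRightInvariant)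
    (hντ : ντ = fun v τ => (νw v).map (ContinuousMulEquiv.restrictSubgroup (GLn.conjEquiv (Matrix.GeneralLinearGroup.mkOfDetNeZero _ (det_monomial_one_ne_zero 3 τ)))
              (archLocal L 3 (Matrix.diagonal (α ∘ ⇑τ)) v) (archLocal L 3 (Matrix.diagonal α) v)
              (mem_archLocal_comp_perm_iff_conj_mem L 3 α v τ)).symm)
    (Θ : Matrix (Fin 3) (Fin 3) (mixedSpace L) → ℂ) (hΘ : ContDiff ℝ (⊤ : ℕ∞) Θ)
    (hΘc : HasCompactSupport fun g : arch (↥(maximalRealSubfield L)) L (IsCMField.complexConj L) 3 (Matrix.diagonal α) => Θ ((g : GL (Fin 3) (mixedSpace L)) : Matrix (Fin 3) (Fin 3) (mixedSpace L))) :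
    haveI : ∀ (v : {w : InfinitePlace L // IsComplex w}) (τ : Perm (Fin 3)), LocallyCompactSpace (archLocal L 3 (Matrix.diagonal (α ∘ ⇑τ)) v) := fun v τ => locallyCompactSpace_archLocal L 3 (Matrix.diagonal (α ∘ ⇑τ)) v
    haveI : ∀ (v : {w : InfinitePlace L // IsComplex w}) (τ : Perm (Fin 3)), SecondCountableTopology (archLocal L 3 (Matrix.diagonal (α ∘ ⇑τ)) v) := fun v τ => secondCountableTopology_archLocal L 3 (Matrix.diagonal (α ∘ ⇑τ)) v
    haveI : ∀ v : {w : InfinitePlace L // IsComplex w}, (νw v).IsHaarMeasure := fun v => (hνw v).1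
    haveI : ∀ v : {w : InfinitePlace L // IsComplex w}, (νw v).IsMulRightInvariant := fun v => (hνw v).2
    haveI : ∀ (v : {w : InfinitePlace L // IsComplex w}) (τ : Perm (Fin 3)), (νH v τ).IsHaarMeasure := fun v τ => (hνH v τ).1
    haveI : ∀ (v : {w : InfinitePlace L // IsComplex w}) (τ : Perm (Fin 3)), (νH v τ).IsInvInvariant := fun v τ => (hνH v τ).2
    haveI : ∀ (v : {w : InfinitePlace L // IsComplex w}) (τ : Perm (Fin 3)), (ντ v τ).IsHaarMeasure := fun v τ => (hντi v τ).1
    haveI : ∀ (v : {w : InfinitePlace L // IsComplex w}) (τ : Perm (Fin 3)), (ντ v τ).IsMulRightInvariant := fun v τ => (hντi v τ).2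
    ∃ c : {w : InfinitePlace L // IsComplex w} → Perm (Fin 3) → ℂ,
      (∀ v τ, (v.1.embedding (α (τ 0))).re * (v.1.embedding (α (τ 2))).re < 0 → c v τ ≠ 0) ∧
      (∀ (v : {w : InfinitePlace L // IsComplex w}) (ρ : Perm (Fin 3)), IsFiniteMeasureOnCompacts (if 0 < (v.1.embedding (α (ρ⁻¹ 0))).re * (v.1.embedding (α (ρ⁻¹ 2))).re then (νw v).map fun y : archLocal L 3 (Matrix.diagonal α) v => y * (⟨circleDiagonal 3 (z0 v ∘ ⇑ρ), circleDiagonal_mem_archLocal_diagonal L 3 α v (z0 v ∘ ⇑ρ)⟩ : archLocal L 3 (Matrix.diagonal α) v) * y⁻¹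
              else ((quotientMeasure _ (νH v ρ⁻¹) (isClosed_coe_centralizer_singleton _) (ντ v ρ⁻¹)).map
                (descConj (⟨circleDiagonal 3 (z0 v), circleDiagonal_mem_archLocal_diagonal L 3 (α ∘ ⇑ρ⁻¹) v (z0 v)⟩ : archLocal L 3 (Matrix.diagonal (α ∘ ⇑ρ⁻¹)) v)
                  (Subgroup.centralizer ({(⟨circleDiagonal 3 (z₁ v), circleDiagonal_mem_archLocal_diagonal L 3 (α ∘ ⇑ρ⁻¹) v (z₁ v)⟩ :
                    archLocal L 3 (Matrix.diagonal (α ∘ ⇑ρ⁻¹)) v)} : Set (archLocal L 3 (Matrix.diagonal (α ∘ ⇑ρ⁻¹)) v)))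
                  (forall_mem_centralizer_circleDiagonal_comm_of_wall L (α ∘ ⇑ρ⁻¹) v (h02 v) (h01 v) (hwall v).1 (hwall v).2) id)).map
                (ContinuousMulEquiv.restrictSubgroup (GLn.conjEquiv (Matrix.GeneralLinearGroup.mkOfDetNeZero _ (det_monomial_one_ne_zero 3 ρ⁻¹)))
              (archLocal L 3 (Matrix.diagonal (α ∘ ⇑ρ⁻¹)) v) (archLocal L 3 (Matrix.diagonal α) v)
              (mem_archLocal_comp_perm_iff_conj_mem L 3 α v ρ⁻¹))) ∧ SigmaFinite (if 0 < (v.1.embedding (α (ρ⁻¹ 0))).re * (v.1.embedding (α (ρ⁻¹ 2))).re then (νw v).map fun y : archLocal L 3 (Matrix.diagonal α) v => y * (⟨circleDiagonal 3 (z0 v ∘ ⇑ρ), circleDiagonal_mem_archLocal_diagonal L 3 α v (z0 v ∘ ⇑ρ)⟩ : archLocal L 3 (Matrix.diagonal α) v) * y⁻¹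
              else ((quotientMeasure _ (νH v ρ⁻¹) (isClosed_coe_centralizer_singleton _) (ντ v ρ⁻¹)).map
                (descConj (⟨circleDiagonal 3 (z0 v), circleDiagonal_mem_archLocal_diagonal L 3 (α ∘ ⇑ρ⁻¹) v (z0 v)⟩ : archLocal L 3 (Matrix.diagonal (α ∘ ⇑ρ⁻¹)) v)
                  (Subgroup.centralizer ({(⟨circleDiagonal 3 (z₁ v), circleDiagonal_mem_archLocal_diagonal L 3 (α ∘ ⇑ρ⁻¹) v (z₁ v)⟩ :
                    archLocal L 3 (Matrix.diagonal (α ∘ ⇑ρ⁻¹)) v)} : Set (archLocal L 3 (Matrix.diagonal (α ∘ ⇑ρ⁻¹)) v)))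
                  (forall_mem_centralizer_circleDiagonal_comm_of_wall L (α ∘ ⇑ρ⁻¹) v (h02 v) (h01 v) (hwall v).1 (hwall v).2) id)).map
                (ContinuousMulEquiv.restrictSubgroup (GLn.conjEquiv (Matrix.GeneralLinearGroup.mkOfDetNeZero _ (det_monomial_one_ne_zero 3 ρ⁻¹)))
              (archLocal L 3 (Matrix.diagonal (α ∘ ⇑ρ⁻¹)) v) (archLocal L 3 (Matrix.diagonal α) v)
              (mem_archLocal_comp_perm_iff_conj_mem L 3 α v ρ⁻¹)))) ∧
      ∀ (w : {w : InfinitePlace L // IsComplex w}) (ι : Type) [Fintype ι] (s : ι → ℂ) (μ : ι → ∀ v : {w : InfinitePlace L // IsComplex w}, Measure (archLocal L 3 (Matrix.diagonal α) v)),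
        (∀ i v, IsFiniteMeasureOnCompacts (μ i v) ∧ SigmaFinite (μ i v)) →
        Tendsto (fun ψ : ℝ => deriv (fun ψ : ℝ => (2 * Real.sin ψ : ℂ) * ∑ i, s i * ∑ ρ : Perm (Fin 3),
            (((∏ v : {w : InfinitePlace L // IsComplex w},
            (Finset.univ.filter fun i => 0 < (v.1.embedding (α i)).re).card.factorial *
              (3 - (Finset.univ.filter fun i => 0 < (v.1.embedding (α i)).re).card).factorial : ℕ) : ℂ)⁻¹ *
                ∫ o, Θ ((((archPiEquivCM 3 L (Matrix.diagonal α)).symm o : arch (↥(maximalRealSubfield L)) L (IsCMField.complexConj L) 3 (Matrix.diagonal α)) : GL (Fin 3) (mixedSpace L)) : Matrix (Fin 3) (Fin 3) (mixedSpace L)) ∂(Measure.pi (Function.update (μ i) w ((νw w).map fun y : archLocal L 3 (Matrix.diagonal α) w => y * (⟨circleDiagonal 3 ((fun j => z0 w j * Circle.exp (![(1 : ℝ), 0, -1] j * ψ)) ∘ ⇑ρ), circleDiagonal_mem_archLocal_diagonal L 3 α w ((fun j => z0 w j * Circle.exp (![(1 : ℝ), 0, -1] j * ψ)) ∘ ⇑ρ)⟩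 : archLocal L 3 (Matrix.diagonal α) w) * y⁻¹))))) ψ)
          (𝓝[>] 0)
          (𝓝 (∑ i, s i * ∑ ρ : Perm (Fin 3), (if 0 < (w.1.embedding (α (ρ⁻¹ 0))).re * (w.1.embedding (α (ρ⁻¹ 2))).re then (2 : ℂ) else c w ρ⁻¹) *
            (((∏ v : {w : InfinitePlace L // IsComplex w},
            (Finset.univ.filter fun i => 0 < (v.1.embedding (α i)).re).card.factorial *
              (3 - (Finset.univ.filter fun i => 0 < (v.1.embedding (α i)).re).card).factorial : ℕ) : ℂ)⁻¹ *
                ∫ o, Θ ((((archPiEquivCM 3 L (Matrix.diagonal α)).symm o : arch (↥(maximalRealSubfield L)) L (IsCMField.complexConj L) 3 (Matrix.diagonal α)) : GL (Fin 3) (mixedSpace L)) : Matrix (Fin 3) (Fin 3) (mixedSpace L)) ∂(Measure.pi (Function.update (μ i) w (if 0 < (w.1.embedding (α (ρ⁻¹ 0))).re * (w.1.embedding (α (ρ⁻¹ 2))).re then (νw w).map fun y : archLocal L 3 (Matrix.diagonal α) w => y * (⟨circleDiagonal 3 (z0 w ∘ ⇑ρ), circleDiagonal_mem_archLocal_diagonal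 L 3 α w (z0 w ∘ ⇑ρ)⟩ : archLocal L 3 (Matrix.diagonal α) w) * y⁻¹
              else ((quotientMeasure _ (νH w ρ⁻¹) (isClosed_coe_centralizer_singleton _) (ντ w ρ⁻¹)).map
                (descConj (⟨circleDiagonal 3 (z0 w), circleDiagonal_mem_archLocal_diagonal L 3 (α ∘ ⇑ρ⁻¹) w (z0 w)⟩ : archLocal L 3 (Matrix.diagonal (α ∘ ⇑ρ⁻¹)) w)
                  (Subgroup.centralizer ({(⟨circleDiagonal 3 (z₁ w), circleDiagonal_mem_archLocal_diagonal L 3 (α ∘ ⇑ρ⁻¹) w (z₁ w)⟩ :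
                    archLocal L 3 (Matrix.diagonal (α ∘ ⇑ρ⁻¹)) w)} : Set (archLocal L 3 (Matrix.diagonal (α ∘ ⇑ρ⁻¹)) w)))
                  (forall_mem_centralizer_circleDiagonal_comm_of_wall L (α ∘ ⇑ρ⁻¹) w (h02 w) (h01 w) (hwall w).1 (hwall w).2) id)).map
                (ContinuousMulEquiv.restrictSubgroup (GLn.conjEquiv (Matrix.GeneralLinearGroup.mkOfDetNeZero _ (det_monomial_one_ne_zero 3 ρ⁻¹)))
              (archLocal L 3 (Matrix.diagonal (α ∘ ⇑ρ⁻¹)) w) (archLocal L 3 (Matrix.diagonal α) w)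
              (mem_archLocal_comp_perm_iff_conj_mem L 3 α w ρ⁻¹)))))))) := by
  classical
  haveI hLCv : ∀ v : {w : InfinitePlace L // IsComplex w}, LocallyCompactSpace (archLocal L 3 (Matrix.diagonal α) v) := fun v => locallyCompactSpace_archLocal L 3 (Matrix.diagonal α) v
  haveI hSCv : ∀ v : {w : InfinitePlace L // IsComplex w}, SecondCountableTopology (archLocal L 3 (Matrix.diagonal α) v) := fun v => secondCountableTopology_archLocal L 3 (Matrix.diagonal α) v
  haveI hLC : ∀ (v : {w : InfinitePlace L // IsComplex w}) (τ : Perm (Fin 3)), LocallyCompactSpace (archLocal L 3 (Matrix.diagonal (α ∘ ⇑τ)) v) :=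
    fun v τ => locallyCompactSpace_archLocal L 3 (Matrix.diagonal (α ∘ ⇑τ)) v
  haveI hSC : ∀ (v : {w : InfinitePlace L // IsComplex w}) (τ : Perm (Fin 3)), SecondCountableTopology (archLocal L 3 (Matrix.diagonal (α ∘ ⇑τ)) v) :=
    fun v τ => secondCountableTopology_archLocal L 3 (Matrix.diagonal (α ∘ ⇑τ)) v
  have hreal : ∀ (v : {w : InfinitePlace L // IsComplex w}) (i : Fin 3), (v.1.embedding (α i)).im = 0 := fun v i => im_embedding_eq_zero_of_complexConj_eq L v (hherm i)
  -- J1's constants, place by place (★ p841638, opaque transported measures)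
  have hpl := fun (w : {w : InfinitePlace L // IsComplex w}) (_h1 : (νw w).IsHaarMeasure) (_h2 : (νw w).IsMulRightInvariant)
      (_h3 : ∀ τ : Perm (Fin 3), (νH w τ).IsHaarMeasure) (_h4 : ∀ τ : Perm (Fin 3), (νH w τ).IsInvInvariant)
      (_h5 : ∀ τ : Perm (Fin 3), (ντ w τ).IsHaarMeasure) (_h6 : ∀ τ : Perm (Fin 3), (ντ w τ).IsMulRightInvariant) =>
    exists_tendsto_deriv_sin_mul_sum_sum_integral_pi_update_splitCurve_of_eq L α w hα hherm (νw w) (z₁ w) (h02 w) (h01 w) (νH w) (ντ w) (by rw [hντ])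
  have hpl' := fun w : {w : InfinitePlace L // IsComplex w} =>
    hpl w (hνw w).1 (hνw w).2 (fun τ => (hνH w τ).1) (fun τ => (hνH w τ).2) (fun τ => (hντi w τ).1) (fun τ => (hντi w τ).2)
  choose c hc hJ using hpl'
  refine ⟨c, hc, fun v ρ => ?_, fun w ι _ s μ hμ => ?_⟩
  · -- the wall measures are Radon
    by_cases hcw : 0 < (v.1.embedding (α (ρ⁻¹ 0))).re * (v.1.embedding (α (ρ⁻¹ 2))).re
    · rw [if_pos hcw]
      haveI : IsFiniteMeasureOnCompacts (νw v) := (hνw v).1.toIsFiniteMeasureOnCompacts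
      haveI hfc := isFiniteMeasureOnCompacts_map_conj_of_proper L 3 α v (νw v) _ fun C hC =>
        isCompact_setOf_conj_circleDiagonal_comp_perm_mem_of_compactWall L α v hα (hreal v) (z0 v) (hwall v).1 (hwall v).2 ρ hcw C hC
      haveI hlf : IsLocallyFiniteMeasure ((νw v).map fun y : archLocal L 3 (Matrix.diagonal α) v =>
          y * (⟨circleDiagonal 3 (z0 v ∘ ⇑ρ), circleDiagonal_mem_archLocal_diagonal L 3 α v (z0 v ∘ ⇑ρ)⟩ : archLocal L 3 (Matrix.diagonal α) v) * y⁻¹) :=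
        isLocallyFiniteMeasure_of_isFiniteMeasureOnCompacts
      exact ⟨hfc, sigmaFinite_of_locallyFinite⟩
    · rw [if_neg hcw]
      haveI := (hνH v ρ⁻¹).1; haveI := (hνH v ρ⁻¹).2; haveI := (hντi v ρ⁻¹).1; haveI := (hντi v ρ⁻¹).2
      have hdet : (Matrix.diagonal (α ∘ ⇑ρ⁻¹)).det ≠ 0 := by
        rw [Matrix.det_diagonal]; exact Finset.prod_ne_zero_iff.mpr fun i _ => hα _
      have hab : ((z0 v 0 : Circle) : ℂ) ≠ z0 v 1 := fun h => (hwall v).2 (Subtype.val_injective h)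
      have hO := isClosed_conjClass_archLocal_of_mul_sub_eq_zero L 3 (Matrix.diagonal (α ∘ ⇑ρ⁻¹)) v
        (map_cmConjRingHom_transpose_diagonal L (α ∘ ⇑ρ⁻¹) fun i => hherm _) hdet
        (⟨circleDiagonal 3 (z0 v), circleDiagonal_mem_archLocal_diagonal L 3 (α ∘ ⇑ρ⁻¹) v (z0 v)⟩ : archLocal L 3 (Matrix.diagonal (α ∘ ⇑ρ⁻¹)) v)
        hab (mul_sub_eq_zero_circleDiagonal_wall L (α ∘ ⇑ρ⁻¹) v (hwall v).1)
      have hMeq := centralizer_circleDiagonal_eq_of_wall L (α ∘ ⇑ρ⁻¹) v (h02 v) (h01 v) (hwall v).1 (hwall v).2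
      haveI := isFiniteMeasureOnCompacts_map_map_descConj_id _ _
        (forall_mem_centralizer_circleDiagonal_comm_of_wall L (α ∘ ⇑ρ⁻¹) v (h02 v) (h01 v) (hwall v).1 (hwall v).2) hO hMeq
        (quotientMeasure _ (νH v ρ⁻¹) (isClosed_coe_centralizer_singleton _) (ντ v ρ⁻¹))
        (ContinuousMulEquiv.restrictSubgroup (GLn.conjEquiv (Matrix.GeneralLinearGroup.mkOfDetNeZero _ (det_monomial_one_ne_zero 3 ρ⁻¹)))
              (archLocal L 3 (Matrix.diagonal (α ∘ ⇑ρ⁻¹)) v) (archLocal L 3 (Matrix.diagonal α) v)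
              (mem_archLocal_comp_perm_iff_conj_mem L 3 α v ρ⁻¹))
      haveI hlf : IsLocallyFiniteMeasure (((quotientMeasure _ (νH v ρ⁻¹) (isClosed_coe_centralizer_singleton _) (ντ v ρ⁻¹)).map
                (descConj (⟨circleDiagonal 3 (z0 v), circleDiagonal_mem_archLocal_diagonal L 3 (α ∘ ⇑ρ⁻¹) v (z0 v)⟩ : archLocal L 3 (Matrix.diagonal (α ∘ ⇑ρ⁻¹)) v)
                  (Subgroup.centralizer ({(⟨circleDiagonal 3 (z₁ v), circleDiagonal_mem_archLocal_diagonal L 3 (α ∘ ⇑ρ⁻¹) v (z₁ v)⟩ :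
                    archLocal L 3 (Matrix.diagonal (α ∘ ⇑ρ⁻¹)) v)} : Set (archLocal L 3 (Matrix.diagonal (α ∘ ⇑ρ⁻¹)) v)))
                  (forall_mem_centralizer_circleDiagonal_comm_of_wall L (α ∘ ⇑ρ⁻¹) v (h02 v) (h01 v) (hwall v).1 (hwall v).2) id)).map
                (ContinuousMulEquiv.restrictSubgroup (GLn.conjEquiv (Matrix.GeneralLinearGroup.mkOfDetNeZero _ (det_monomial_one_ne_zero 3 ρ⁻¹)))
              (archLocal L 3 (Matrix.diagonal (α ∘ ⇑ρ⁻¹)) v) (archLocal L 3 (Matrix.diagonal α) v)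
              (mem_archLocal_comp_perm_iff_conj_mem L 3 α v ρ⁻¹))) :=
        isLocallyFiniteMeasure_of_isFiniteMeasureOnCompacts
      exact ⟨this, sigmaFinite_of_locallyFinite⟩
  · -- the one-step jump for the scaled state: ★ p841638 with scalars `s i · K⁻¹`
    have h := hJ w Θ hΘ hΘc ι (fun i => s i * ((∏ v : {w : InfinitePlace L // IsComplex w},
            (Finset.univ.filter fun i => 0 < (v.1.embedding (α i)).re).card.factorial *
              (3 - (Finset.univ.filter fun i => 0 < (v.1.embedding (α i)).re).card).factorial : ℕ) : ℂ)⁻¹) μ hμ (z0 w) (hwall w).1 (hwall w).2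
    convert h using 2
    · congr 1
      funext ψ'
      congr 1
      refine Finset.sum_congr rfl fun i _ => ?_
      rw [Finset.mul_sum, Finset.mul_sum]
      exact Finset.sum_congr rfl fun ρ _ => by ring
    · refine Finset.sum_congr rfl fun i _ => ?_
      rw [Finset.mul_sum, Finset.mul_sum]
      exact Finset.sum_congr rfl fun ρ _ => by ring

end Literature.NumberTheory.Rogawski1990

end
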